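import Summits.ResolutionOfSingularities.ResolutionOfSingularities.Theorems.SyzygyFlatteningGlobalisationCentreChart
import Summits.ResolutionOfSingularities.ResolutionOfSingularities.Theorems.SyzygyFlatteningGlobalisationSyzygyDatumChartAux
import HarnessLib

/-!
# The verbatim chart at a centre is the blow-up chart of a minimal minor — `stub_syzygyDatumChart`

Crux `SyzygyFlattening.Globalisation` (stmt-ResolutionOfSingularities-17061), line `birth`,
registered stub `stub_syzygyDatumChart`.

Setting: `M` a proper model of `K/k`, `v ∈ Zar(K/k)` with centre `x ∈ U` (`U` affine),
`sec : Γ(M, U) → 𝒪_{M,x} → K` the sections read in `K`, `A = im sec ⊆ K` the affine chart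
(`stub_centreChart`: `A` finitely generated, `Frac A = K`, `A ⊆ 𝒪_v`, and the local ring
`B = im (𝒪_{M,x} → K)` is `locAt 𝒪_v A`), and a syzygy norm ideal datum over `Γ(M, U)`: a finite
free resolution `F` of `Γ(M, U) ⧸ J` (`J` the ideal of the non-regular locus), an injective
framing `φ` of the syzygy module `F.syzygy (n - 1)` (`n = syzygyIndex k K`) and its ideal of
maximal minors `N = normIdeal φ`. Claim: for every non-zero `u₀ ∈ N` of minimal `v`-value,
`locAt 𝒪_v (chart 𝒪_v B) = locAt 𝒪_v (k[im sec, sec N / sec u₀])`.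

Proof (transport and bookkeeping around the landed valuation-local algebra; the scheme-free
lemmas are in `SyzygyFlatteningGlobalisationSyzygyDatumChartAux.lean`):
* `chart_locAt_eq_of_datum` — over an affine chart `A ⊆ 𝒪_v` presented by a ring isomorphism
  `f : R ≅ A`: the ideal of the non-regular locus of `R` goes to `singIdeal A`
  (`map_sInf_nonRegular_of_bijective`), the raw datum `(F.rank, F.d, F.ε, r, φ)` goes to a datum
  over `A` (`datum_of_bijective`) whose maximal minors are the images of those of `φ` and lie in
  `N · A`; an `𝒪_v`-minimal tuple `x₁` exists (`IsFraming.exists_det_div_mem`); the datum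
  localises to `B = locAt 𝒪_v A` (`stub_localizedDatum`, its `J`-hypothesis being
  `stub_singIdeal_locAt`) and the chart at `B` is in canonical form (`stub_chart_canonical` with
  `indep_hyp`), whence `locAt 𝒪_v (chart 𝒪_v B) = locAt 𝒪_v (A[det ι₁ g / det ι₁ x₁])`; finally
  the minimal generator is switched, `det ι₁ x₁ ↦ sec u₀` (`locAt_adjoin_minors_eq_adjoin_ideal`:
  both have the maximal value on `N`, so their ratio is an `𝒪_v`-unit of both algebras; the
  ratios `sec n / det ι₁ x₁` lie in the algebra by the span argument `ratio_mem_of_mem_span`).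
* `syzygyDatumChart_of` — back on the proper model: `A = im sec`, `B = locAt 𝒪_v A`
  (`stub_centreChart`), and `sec` corestricts to a ring isomorphism `Γ(M, U) ≅ A` (injective
  since `M` is integral, `germ_injective_of_isIntegral`).

Sources: Novacoski–Spivakovsky 2014, Def. 2.11 (the chart of a local blowing up selected by a
valuation); Villamayor 2006, 3.4 (the ideal of maximal minors and its representatives);
Zariski–Samuel II, Ch. VI §17 (local rings of a model inside `K`); Matsumura §19.
-/

noncomputable section

-- single-problem summit: the doubled namespace component `ResolutionOfSingularities` is forced
set_option linter.dupNamespace false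

namespace Summit.ResolutionOfSingularities.ResolutionOfSingularities.Theorems.SyzygyFlattening

open CategoryTheory AlgebraicGeometry TopologicalSpace
open Literature.AlgebraicGeometry.Resolution

variable {k K : Type} [Field k] [Field K] [Algebra k K]

/-! ## The main argument, over the affine chart `A` -/

/-- **The chart at `B = locAt O A`, localised, is `A[N/u₀]` localised** — the algebraic content of
`stub_syzygyDatumChart` over an affine chart `A ⊆ O` (`A` finitely generated, `Frac A = K`)
presented by a ring isomorphism `f : R ≅ A` read in `K` as `sec`. Transport the datum along `f`
(`datum_of_bijective`, `map_sInf_nonRegular_of_bijective`), pick an `O`-minimal tuple `x₁`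
(`IsFraming.exists_det_div_mem`), localise (`stub_localizedDatum`, `stub_singIdeal_locAt`), put
the chart in canonical form (`stub_chart_canonical`, `indep_hyp`), and switch the minimal
generator `det ι₁ x₁ ↦ sec u₀` (`locAt_adjoin_minors_eq_adjoin_ideal`, the span argument
`ratio_mem_of_mem_span`). [cite: NovacoskiSpivakovsky2014, Def. 2.11] -/
theorem chart_locAt_eq_of_datum (O : ValuationSubring K) (hk : ∀ c : k, algebraMap k K c ∈ O)
    (A : Subalgebra k K) (hAO : A.toSubring ≤ O.toSubring) (hAFG : A.FG)
    (hAFrac : IsFractionRing ↥A K) {R : Type*} [CommRing R] [IsDomain R] (f : R →+* ↥A)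
    (hf : Function.Bijective f) (sec : R → K) (hfK : ∀ z, ((f z : ↥A) : K) = sec z)
    (N : Ideal R) (b : ℕ → ℕ) (d : (i : ℕ) → ((Fin (b (i + 1)) → R) →ₗ[R] (Fin (b i) → R)))
    (ε : (Fin (b 0) → R) →ₗ[R] (R ⧸
      sInf ((fun 𝔭 : PrimeSpectrum R => 𝔭.asIdeal) ''
        {𝔭 : PrimeSpectrum R | ¬ IsRegularLocalRing (Localization.AtPrime 𝔭.asIdeal)})))
    (r : ℕ) (φ : ↥(LinearMap.range (d (syzygyIndex k K - 1))) →ₗ[R] (Fin r → R))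
    (hε : Function.Surjective ε) (h0 : Function.Exact (d 0) ε)
    (hs : ∀ i : ℕ, Function.Exact (d (i + 1)) (d i)) (hφ : Function.Injective φ)
    (hfr : IsFraming φ) (hN : N = normIdeal φ) (u₀ : R) (hu₀ : u₀ ∈ N) (hu₀0 : u₀ ≠ 0)
    (hmin : ∀ n ∈ N, O.valuation (sec n) ≤ O.valuation (sec u₀)) :
    locAt O (chart O (locAt O A)) =
      locAt O (Algebra.adjoin k (Set.range sec ∪ {y : K | ∃ n ∈ N, y = sec n * (sec u₀)⁻¹})) := by
  -- `sec` is injective, with values in `A ⊆ O`, onto `A`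
  have hsec_inj : Function.Injective sec := fun a a' h =>
    hf.injective (Subtype.ext (by rw [hfK, hfK, h]))
  have hsecO : ∀ z, sec z ∈ O := fun z => by
    rw [← hfK]
    exact hAO (f z).2
  have hSA : Set.range sec ⊆ (O : Set K) := by
    rintro _ ⟨z, rfl⟩
    exact hsecO z
  have hAcar : (A : Set K) = Set.range sec := by
    ext y
    constructor
    · intro hy
      obtain ⟨z, hz⟩ := hf.surjective ⟨y, hy⟩
      exact ⟨z, by rw [← hfK, hz]⟩
    · rintro ⟨z, rfl⟩
      rw [← hfK]
      exact (f z).2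
  have hAT : ∀ T : Subring K, Set.range sec ⊆ T → ∀ a : ↥A, algebraMap ↥A K a ∈ T :=
    fun T hT a => by
      have ha : (a : K) ∈ (A : Set K) := a.2
      rw [hAcar] at ha
      exact hT ha
  have hsu0 : sec u₀ ≠ 0 := fun h => hu₀0 (hsec_inj (by
    rw [h, ← hfK, map_zero]
    rfl))
  -- the minimality of `u₀`, as ratios
  have hminU : ∀ n ∈ N, sec n * (sec u₀)⁻¹ ∈ O := fun n hn => by
    have hv0 : O.valuation (sec u₀) ≠ 0 := by simpa using hsu0
    rw [← div_eq_mul_inv, ← O.valuation_le_one_iff, map_div₀,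
      div_le_one₀ (pos_iff_ne_zero.mpr hv0)]
    exact hmin n hn
  -- torsion cokernel, with nonzero multipliers
  have htors : ∀ z : Fin r → R, ∃ a : R, a ≠ 0 ∧ a • z ∈ LinearMap.range φ := fun z => by
    obtain ⟨a, ha, h⟩ := hfr.exists_smul_mem z
    exact ⟨a, nonZeroDivisors.ne_zero ha, h⟩
  -- the ideal of the non-regular locus is transported to `singIdeal A`
  have hJ : singIdeal A = (sInf ((fun 𝔭 : PrimeSpectrum R => 𝔭.asIdeal) ''
      {𝔭 : PrimeSpectrum R | ¬ IsRegularLocalRing (Localization.AtPrime 𝔭.asIdeal)})).map f :=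
    (map_sInf_nonRegular_of_bijective f hf).symm
  -- the datum over `A`
  obtain ⟨d₁, ε₁, ι₁, ⟨hε₁, h0₁, hs₁, hι₁, htors₁⟩, hP1, hP2⟩ :=
    datum_of_bijective f hf _ (singIdeal A) hJ (syzygyIndex k K - 1) b d ε r φ hε h0 hs hφ htors
  -- the maximal minors of `φ`, read in `K`, are maximal minors of the `A`-datum
  have hdetK : ∀ g : Fin r → ↥(LinearMap.range (d (syzygyIndex k K - 1))),
      ∃ g₁ : Fin r → ↥(LinearMap.range (d₁ (syzygyIndex k K - 1))),
        Matrix.det (Matrix.of fun i j => ((ι₁ (g₁ i) j : ↥A) : K)) =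
          sec (Matrix.det (Matrix.of fun i j => φ (g i) j)) := fun g => by
    have h3 := hP1 g
    obtain ⟨g₁, hg₁⟩ := h3
    refine ⟨g₁, ?_⟩
    rw [← hfK, ringHom_det_of f (fun i j => φ (g i) j)]
    refine Eq.trans ?_ (ringHom_det_of (algebraMap ↥A K) (fun i j => f (φ (g i) j))).symm
    congr 1
    ext i j
    exact congrArg (fun t : ↥A => (t : K)) (hg₁ i j)
  -- an `O`-minimal tuple `x₁` of the `A`-datum
  obtain ⟨x₁, hx0₁, hmin₁⟩ : ∃ x₁ : Fin r → ↥(LinearMap.range (d₁ (syzygyIndex k K - 1))),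
      Matrix.det (Matrix.of fun i j => ((ι₁ (x₁ i) j : ↥A) : K)) ≠ 0 ∧
      ∀ g : Fin r → ↥(LinearMap.range (d₁ (syzygyIndex k K - 1))),
        Matrix.det (Matrix.of fun i j => ((ι₁ (g i) j : ↥A) : K)) *
          (Matrix.det (Matrix.of fun i j => ((ι₁ (x₁ i) j : ↥A) : K)))⁻¹ ∈ O := by
    have hD : ∀ g : Fin r → ↥(LinearMap.range (d₁ (syzygyIndex k K - 1))),
        algebraMap ↥A K (frameMatrix ι₁ g).det =
          Matrix.det (Matrix.of fun i j => ((ι₁ (g i) j : ↥A) : K)) := fun g =>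
      ringHom_det_of (algebraMap ↥A K) (fun i j => ι₁ (g i) j)
    have h4 := (IsFraming.of_injective hι₁ htors₁).exists_det_div_mem O
      (fun a a' h => Subtype.ext h) (fun a => hAO a.2)
    obtain ⟨x₁, hx0, hle⟩ := h4
    refine ⟨x₁, by rw [← hD]; exact hx0, fun g => ?_⟩
    rw [← hD, ← hD, ← div_eq_mul_inv]
    exact hle g
  -- the datum localises to `B = locAt O A`
  have hEss : Algebra.EssFiniteType k ↥A := by
    haveI : Algebra.FiniteType k ↥A := (Subalgebra.fg_iff_finiteType A).mp hAFG
    infer_instance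
  have hJloc := stub_singIdeal_locAt k K O A hAO hEss hAFrac
  have h5 := stub_localizedDatum k K O O A hk le_rfl hAO hAFrac hJloc b d₁ ε₁ r ι₁ x₁ hε₁ h0₁ hs₁
    hι₁ htors₁ hx0₁ hmin₁
  obtain ⟨b₂, d₂, ε₂, r₂, ι₂, x₂, ⟨hε₂, h0₂, hs₂, hι₂, htors₂⟩, hx0₂, hmin₂, hadj⟩ := h5
  -- the chart at `B`, in canonical form
  have hBO : (locAt O A).toSubring ≤ O.toSubring := locAt_le O A hAO
  have hCF := stub_chart_canonical k K O O (locAt O A) hk le_rfl hBO b₂ d₂ ε₂ r₂ ι₂ x₂ hε₂ h0₂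
    hs₂ hι₂ htors₂ hx0₂ hmin₂ (indep_hyp (locAt O A) b₂ d₂ ε₂ r₂ ι₂ hε₂ h0₂ hs₂ hι₂ htors₂)
  rw [hCF, hadj, hAcar]
  -- the switch of minimal generators `det ι₁ x₁ ↦ sec u₀`
  have Hsu : ∀ T : Subring K, Set.range sec ⊆ T → (∀ n ∈ N, sec n * (sec u₀)⁻¹ ∈ T) →
      ∀ g' : Fin r → ↥(LinearMap.range (d₁ (syzygyIndex k K - 1))),
        Matrix.det (Matrix.of fun i j => ((ι₁ (g' i) j : ↥A) : K)) * (sec u₀)⁻¹ ∈ T := by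
    intro T hT hNT g'
    have hgen : ∀ g : Fin r → ↥(LinearMap.range (d (syzygyIndex k K - 1))),
        algebraMap ↥A K (f (Matrix.det (Matrix.of fun i j => φ (g i) j))) * (sec u₀)⁻¹ ∈ T :=
      fun g => by
        rw [show algebraMap ↥A K (f (Matrix.det (Matrix.of fun i j => φ (g i) j))) =
          sec (Matrix.det (Matrix.of fun i j => φ (g i) j)) from hfK _]
        exact hNT (Matrix.det (Matrix.of fun i j => φ (g i) j)) (hN ▸ det_mem_normIdeal φ g)
    have key := ratio_mem_of_mem_span f (algebraMap ↥A K)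
      (fun g : Fin r → ↥(LinearMap.range (d (syzygyIndex k K - 1))) =>
        Matrix.det (Matrix.of fun i j => φ (g i) j))
      (sec u₀) T (hAT T hT) hgen (hP2 g')
    rwa [ringHom_det_of] at key
  have HDx : ∀ T : Subring K, Set.range sec ⊆ T →
      (∀ g' : Fin r → ↥(LinearMap.range (d₁ (syzygyIndex k K - 1))),
        Matrix.det (Matrix.of fun i j => ((ι₁ (g' i) j : ↥A) : K)) *
          (Matrix.det (Matrix.of fun i j => ((ι₁ (x₁ i) j : ↥A) : K)))⁻¹ ∈ T) →
      ∀ n ∈ N, sec n * (Matrix.det (Matrix.of fun i j => ((ι₁ (x₁ i) j : ↥A) : K)))⁻¹ ∈ T := by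
    intro T hT hRT n hn
    have hgen : ∀ g : Fin r → ↥(LinearMap.range (d (syzygyIndex k K - 1))),
        algebraMap ↥A K (f (Matrix.det (Matrix.of fun i j => φ (g i) j))) *
          (Matrix.det (Matrix.of fun i j => ((ι₁ (x₁ i) j : ↥A) : K)))⁻¹ ∈ T := fun g => by
      obtain ⟨g₁, hg₁⟩ := hdetK g
      rw [show algebraMap ↥A K (f (Matrix.det (Matrix.of fun i j => φ (g i) j))) =
        sec (Matrix.det (Matrix.of fun i j => φ (g i) j)) from hfK _, ← hg₁]
      exact hRT g₁
    have hy : f n ∈ Ideal.span (Set.range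
        fun g : Fin r → ↥(LinearMap.range (d (syzygyIndex k K - 1))) =>
          f (Matrix.det (Matrix.of fun i j => φ (g i) j))) := by
      have h1 : n ∈ normIdeal φ := hN ▸ hn
      have h2 := Ideal.mem_map_of_mem f h1
      rw [normIdeal, Ideal.map_span, ← Set.range_comp] at h2
      exact h2
    have key := ratio_mem_of_mem_span f (algebraMap ↥A K)
      (fun g : Fin r → ↥(LinearMap.range (d (syzygyIndex k K - 1))) =>
        Matrix.det (Matrix.of fun i j => φ (g i) j))
      _ T (hAT T hT) hgen hy
    rwa [show algebraMap ↥A K (f n) = sec n from hfK n] at key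
  exact locAt_adjoin_minors_eq_adjoin_ideal O hk hSA
    (fun g : Fin r → ↥(LinearMap.range (d₁ (syzygyIndex k K - 1))) =>
      Matrix.det (Matrix.of fun i j => ((ι₁ (g i) j : ↥A) : K)))
    x₁ hx0₁ hmin₁ sec N u₀ hu₀ hsu0 hminU Hsu HDx

/-! ## Back to the proper model -/

/-- **The verbatim chart, localised, is the blow-up chart `A[N/u₀]` of a minimal minor** (the
registered statement with the sections map `sec` as an argument): `A = im sec` and
`B = locAt 𝒪_v A` by `stub_centreChart`, `sec` corestricts to a ring isomorphism `Γ(M, U) ≅ A`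
(injective since `M` is integral), and `chart_locAt_eq_of_datum` applies.
[cite: ZariskiSamuel1960, Ch. VI §17] -/
theorem syzygyDatumChart_of (M : ProperModel k K) (v : ZariskiRiemannSpace k K) (U : M.X.Opens)
    (hU : IsAffineOpen U) (hx : M.centre v ∈ U) (B : Subalgebra k K)
    (hB : B.toSubring = ((M.X.presheaf.stalkSpecializes (genericPoint_specializes (M.centre v)) ≫
        M.funFieldIso.hom).hom).range)
    (N : Ideal Γ(M.X, U))
    (F : FreeResolution Γ(M.X, U) (Γ(M.X, U) ⧸
        sInf ((fun 𝔭 : PrimeSpectrum Γ(M.X, U) => 𝔭.asIdeal) ''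
          {𝔭 : PrimeSpectrum Γ(M.X, U) | ¬ IsRegularLocalRing (Localization.AtPrime 𝔭.asIdeal)})))
    (r : ℕ) (φ : ↥(F.syzygy (syzygyIndex k K - 1)) →ₗ[Γ(M.X, U)] (Fin r → Γ(M.X, U)))
    (hφ : Function.Injective φ) (hfr : IsFraming φ) (hN : N = normIdeal φ)
    (u₀ : Γ(M.X, U)) (hu₀ : u₀ ∈ N) (hu₀0 : u₀ ≠ 0) (sec : Γ(M.X, U) →+* K)
    (hsec : sec = ((M.X.presheaf.stalkSpecializes (genericPoint_specializes (M.centre v)) ≫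
        M.funFieldIso.hom).hom).comp (M.X.presheaf.germ U (M.centre v) hx).hom)
    (hmin : ∀ n ∈ N, v.asValuationSubring.valuation (sec n) ≤
      v.asValuationSubring.valuation (sec u₀)) :
    locAt v.asValuationSubring (chart v.asValuationSubring B) =
      locAt v.asValuationSubring (Algebra.adjoin k
        (Set.range sec ∪ {y : K | ∃ n ∈ N, y = sec n * (sec u₀)⁻¹})) := by
  have hk : ∀ c : k, algebraMap k K c ∈ v.asValuationSubring := v.algebraMap_mem
  -- the chart `A = im sec`, and `B = locAt O A`
  obtain ⟨-, A, hAcar, hAFG, hAFrac, hAO, hlocA⟩ := stub_centreChart k K M v U hU hx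
  rw [← hsec] at hAcar
  have hBA : B = locAt v.asValuationSubring A :=
    Subalgebra.toSubring_injective (by rw [hB, hlocA])
  subst hBA
  haveI : Nonempty U := ⟨⟨_, hx⟩⟩
  -- `sec` is injective and corestricts to a ring isomorphism onto `A`
  have hsec_inj : Function.Injective sec := by
    rw [hsec, RingHom.coe_comp]
    exact (centreChart_stalkToK_injective M (M.centre v)).comp
      (germ_injective_of_isIntegral M.X (M.centre v) hx)
  have hsecA : ∀ z, sec z ∈ A := fun z => by
    rw [← SetLike.mem_coe, hAcar]
    exact ⟨z, rfl⟩
  obtain ⟨f, hfK⟩ : ∃ f : Γ(M.X, U) →+* ↥A, ∀ z, ((f z : ↥A) : K) = sec z :=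
    ⟨sec.codRestrict A hsecA, fun _ => rfl⟩
  have hf : Function.Bijective f := by
    refine ⟨fun a a' h => hsec_inj ?_, fun a => ?_⟩
    · rw [← hfK a, ← hfK a', h]
    · have ha : (a : K) ∈ (A : Set K) := a.2
      rw [hAcar] at ha
      obtain ⟨z, hz⟩ := ha
      exact ⟨z, Subtype.ext ((hfK z).trans hz)⟩
  exact chart_locAt_eq_of_datum v.asValuationSubring hk A hAO hAFG hAFrac f hf sec hfK N F.rank
    F.d F.ε r φ F.ε_surjective F.exact_zero F.exact_succ hφ hfr hN u₀ hu₀ hu₀0 hmin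

/-! ## The registered stub -/

/-- **`stub_syzygyDatumChart`, ζ-reduced** — the statement of the registered stub below with its
`let sec : Γ(M.X, U) →+* K := (𝒪_{M,x} → K) ∘ germ_x` written out at each occurrence (the same
proposition definitionally; this is the form under which the sub-goal is registered on the crux,
a stub signature being unable to carry a `:=`). Proof: `syzygyDatumChart_of` at the composite,
`rfl`. [cite: NovacoskiSpivakovsky2014, Def. 2.11] -/
theorem stub_syzygyDatumChart_zeta : ∀ (k K : Type) [Field k] [Field K] [Algebra k K]
    (M : ProperModel k K) (v : ZariskiRiemannSpace k K) (U : M.X.Opens) (_hU : IsAffineOpen U)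
    (hx : M.centre v ∈ U) (B : Subalgebra k K),
      B.toSubring = ((M.X.presheaf.stalkSpecializes (genericPoint_specializes (M.centre v)) ≫
          M.funFieldIso.hom).hom).range →
      ∀ (N : Ideal Γ(M.X, U)),
        (∃ (F : FreeResolution Γ(M.X, U) (Γ(M.X, U) ⧸
            sInf ((fun 𝔭 : PrimeSpectrum Γ(M.X, U) => 𝔭.asIdeal) ''
              {𝔭 : PrimeSpectrum Γ(M.X, U) | ¬ IsRegularLocalRing (Localization.AtPrime 𝔭.asIdeal)})))
          (r : ℕ) (φ : ↥(F.syzygy (syzygyIndex k K - 1)) →ₗ[Γ(M.X, U)] (Fin r → Γ(M.X, U))),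
          Function.Injective φ ∧ IsFraming φ ∧ N = normIdeal φ) →
        ∀ u₀ ∈ N, u₀ ≠ 0 →
          (∀ n ∈ N, v.asValuationSubring.valuation
              ((((M.X.presheaf.stalkSpecializes (genericPoint_specializes (M.centre v)) ≫ M.funFieldIso.hom).hom).comp (M.X.presheaf.germ U (M.centre v) hx).hom) n) ≤
            v.asValuationSubring.valuation
              ((((M.X.presheaf.stalkSpecializes (genericPoint_specializes (M.centre v)) ≫ M.funFieldIso.hom).hom).comp (M.X.presheaf.germ U (M.centre v) hx).hom) u₀)) →
          locAt v.asValuationSubring (chart v.asValuationSubring B) =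
            locAt v.asValuationSubring (Algebra.adjoin k
              (Set.range (((M.X.presheaf.stalkSpecializes (genericPoint_specializes (M.centre v)) ≫ M.funFieldIso.hom).hom).comp (M.X.presheaf.germ U (M.centre v) hx).hom) ∪
                {y : K | ∃ n ∈ N, y = (((M.X.presheaf.stalkSpecializes (genericPoint_specializes (M.centre v)) ≫ M.funFieldIso.hom).hom).comp (M.X.presheaf.germ U (M.centre v) hx).hom) n *
                  ((((M.X.presheaf.stalkSpecializes (genericPoint_specializes (M.centre v)) ≫ M.funFieldIso.hom).hom).comp (M.X.presheaf.germ U (M.centre v) hx).hom) u₀)⁻¹})) := by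
  intro k K _ _ _ M v U hU hx B hB N hdatum u₀ hu₀ hu₀0 hmin
  obtain ⟨F, r, φ, hφ, hfr, hN⟩ := hdatum
  exact syzygyDatumChart_of M v U hU hx B hB N F r φ hφ hfr hN u₀ hu₀ hu₀0 _ rfl hmin

/-- **STUB `stub_syzygyDatumChart` (the verbatim chart is the blow-up chart of a minimal minor).** For
`v ∈ Zar(K/k)` with centre `x ∈ U` (affine) on `M`, `B` the local ring of `M` at `x` realised in `K`,
and a syzygy norm ideal datum `N ⊆ Γ(M, U)` at the route's index: for every non-zero `u₀ ∈ N` of minimal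
`v`-value, `locAt 𝒪_v (chart 𝒪_v B) = locAt 𝒪_v (A[N/u₀])`, `A ⊆ K` the image of `Γ(M, U)` — the
skeleton's statement verbatim (with its `let sec := …`). Proof: transport the datum along
`Γ(M,U) ≅ A` (`stub_centreChart`: `B = locAt 𝒪_v A`), localise it at the centre
(`stub_localizedDatum`, `stub_singIdeal_locAt`), use the canonical form of the chart
(`stub_chart_canonical` with `indep_hyp`), and switch the minimal generator — all in
`syzygyDatumChart_of`, applied at the `let`-bound `sec` with `rfl`.
[cite: NovacoskiSpivakovsky2014, Def. 2.11] -/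
theorem stub_syzygyDatumChart : ∀ (k K : Type) [Field k] [Field K] [Algebra k K]
    (M : ProperModel k K) (v : ZariskiRiemannSpace k K) (U : M.X.Opens) (_hU : IsAffineOpen U)
    (hx : M.centre v ∈ U) (B : Subalgebra k K),
      B.toSubring = ((M.X.presheaf.stalkSpecializes (genericPoint_specializes (M.centre v)) ≫
          M.funFieldIso.hom).hom).range →
      ∀ (N : Ideal Γ(M.X, U)),
        (∃ (F : FreeResolution Γ(M.X, U) (Γ(M.X, U) ⧸
            sInf ((fun 𝔭 : PrimeSpectrum Γ(M.X, U) => 𝔭.asIdeal) ''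
              {𝔭 : PrimeSpectrum Γ(M.X, U) | ¬ IsRegularLocalRing (Localization.AtPrime 𝔭.asIdeal)})))
          (r : ℕ) (φ : ↥(F.syzygy (syzygyIndex k K - 1)) →ₗ[Γ(M.X, U)] (Fin r → Γ(M.X, U))),
          Function.Injective φ ∧ IsFraming φ ∧ N = normIdeal φ) →
        ∀ u₀ ∈ N, u₀ ≠ 0 →
          let sec : Γ(M.X, U) →+* K :=
            ((M.X.presheaf.stalkSpecializes (genericPoint_specializes (M.centre v)) ≫
              M.funFieldIso.hom).hom).comp (M.X.presheaf.germ U (M.centre v) hx).hom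
          (∀ n ∈ N, v.asValuationSubring.valuation (sec n) ≤ v.asValuationSubring.valuation (sec u₀)) →
          locAt v.asValuationSubring (chart v.asValuationSubring B) =
            locAt v.asValuationSubring (Algebra.adjoin k
              (Set.range sec ∪ {y : K | ∃ n ∈ N, y = sec n * (sec u₀)⁻¹})) := by
  intro k K _ _ _ M v U hU hx B hB N hdatum u₀ hu₀ hu₀0 sec hmin
  obtain ⟨F, r, φ, hφ, hfr, hN⟩ := hdatum
  exact syzygyDatumChart_of M v U hU hx B hB N F r φ hφ hfr hN u₀ hu₀ hu₀0 sec rfl hmin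

end Summit.ResolutionOfSingularities.ResolutionOfSingularities.Theorems.SyzygyFlattening

end
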